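import Summits.QuantumFields.BalabanUV.T4Continuum.Spine.NE2BalabanDecayRate
import Literature.MathematicalPhysics.QuantumFieldTheory.Balaban1983to89.B5G110BlockRowSum

/-!
# T⁴ programme, spine node NE2 (U1a), sub-row Δ3 (`T4-U1a.S-NE2-D3-WALK°`) — THE DISPLAYED DECAY INPUT `hdec` OF
# `Spine/NE2BalabanDecayRate` DISCHARGED AT `U = 1` (`t = 0`, `a = 1`): the King-averaged free covariance tower
# `pertCovC P 0 k` has LEVEL-UNIFORM exponential entry decay on the unit torus, from pv15's block row sums of (1.110)

NE2 formalisation swarm `b2b-balaban-t4-ne2-formalise-*`, leaf prover 05 (gen 5); supplier item «NE2-Δ3-U1-HDEC» under the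
row owner's sub-row Δ3 (INTENT CLAIMS.log 2026-08-20).  PURE DICTIONARY on landed modules, nothing restated:
 * the analysis is `Literature/…/B5G110BlockRowSum.block_row_sum_le` (unit `b2b-balaban-pv15-g12`): the FIRST ENTRY of
   [Balaban1984PropagatorsI] Prop. 1.2 (1.110) p. 35 in `ℓ¹` BLOCK ROW-SUM currency for `G = (DeltaA n M 1)⁻¹` on the fine
   torus, with constants and rates depending on the dimension and the truncation order only — uniform in `n = L^k` and in
   the volume;
 * the dictionary is `NE2ColourPerturbedLayer.pertCovC_zero` + `ColourPerturbedStations.avgTow_kron` (the colour lift is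
   `⊗ 1` at `t = 0`), `Atow (Qlev) k = B5G183RateUnitTower.Qtow k` (same recursion) so that
   `avgTow Qlev (L^d) X k = unitAvg X k` whose entries are BLOCK MEANS (`B5G183RateUnitTower.unitAvg_apply`, King's (2.10)
   semigroup property), `calGlev k = calG n_k = (DeltaA n_k M a)⁻¹` (`B5DeltaA169.calG_eq_DeltaA_inv`), and every fine site
   is a block point `bpt y r` (`B5Blocks16`).

WHAT IS PROVED (dimension written `d + 1` in §3–§4; every `L`, every torus `M`, every colour index type `o`):
 * §1 `Atow_Qlev`, `avgTow_Qlev_eq_unitAvg`, `pertCovC_zero_apply`: at `t = 0` the colour tower's entries are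
   `δ_{cc′}·(unitAvg calGlev k)_{(x,μ),(x′,ν)}` — for EVERY perturbation family `P` and every `a > 0`;
 * §2 block bookkeeping on the unit torus (a unit-lattice index `x ∈ Tor (fine (lev L 0) M)` is read in `Tor M` as
   `⟦x⟧ := (ν ↦ (x ν).val)`, inline): `block_cond_iff` (the block condition of `unitAvg_apply` is `blockOf = ⟦x⟧`),
   `sum_block_ite`, and **`norm_unitAvg_apply_le`**: a per-block `ℓ¹` ROW-SUM bound `R(z, z′)` for `X_k` bounds the ENTRY
   `((x,μ),(x′,ν))` of `unitAvg X k` by `R(⟦x⟧, ⟦x′⟧)` (the block mean's `n^{−d}` against the `n^d` rows of `B(x)`);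
 * §3 (`a = 1`): **`entryDecay_pertCovC_zero`** — `EntryDecay dist₀ (pertCovC L M 1 _ P 0 k) (C₁ + (d+1)C₂) (min δ₁ δ₂)` for
   every `k`, pv15's constants `C₁ = 2d·2^d·e^{δ₁}`, `δ₁ = 1/(2(d+1))`, `C₂ = MD183(d+1,d)·periodConst(κ₁₈₃(d+1),d)`,
   `δ₂ = κ₁₈₃(d+1)/(d+1)` (truncation order `N := d`), `dist₀` = the sup-distance of the unit torus `Π_ν ℤ/M_ν` between the
   sites (`B4TorusKernel.MultiPeriod.torusSupNorm` of the value representatives; colour and component ignored);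
 * §4 ENDs with `hdec` DISCHARGED: **`decayStations_pertCovC_zero`** (the owner's `decayStations_pertCovC` at `t = 0`, any
   family obeying the laws) and **`decayStations_free`** (`P := 0`; binder `L ≥ 2` and NOTHING ELSE): at `U = 1` the free
   King-averaged colour tower converges to `pertLimC … 0` with limit entry decay `(C₁ + (d+1)C₂, min δ₁ δ₂)` and King's (4.38)
   limit / two-level shapes `(√(…), (min δ₁ δ₂)/2, √(L⁻¹))` UNCONDITIONALLY — the `U = 1` witness of sub-row Δ3's conversion.

RELATION TO THE OWNER's `Support/BlockSumDecay` (p219633, landed while this file was in hold-off): that file types the dictionary in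
the DOUBLE block-ℓ¹ currency (`BlockL1Decay` ⟹ `hdec`, any `t`, a SHAPE asserted by nobody); this file works in the PER-ROW block
row-sum currency that pv15's (1.110) module delivers and supplies the `U = 1` DISCHARGE, which p219633 does not contain.

HONEST FRAMING (T4-DAG p. 1).  `U = 1` FREE FIELD ONLY, `a = 1` (pv15's convention for the (1.83) symbol), finite torus,
operator entries; rates and constants crude and pv15's, nothing printed is matched — (1.110) p. 35 is a TEXT LOCATION; for
`U ≠ 1` (Bałaban's background carriers: dictionary B0, NE2⁺) `hdec` stays DISPLAYED in the owner's file; sub-row Δ3 is NOT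
closed; nothing of node NE3; **NE2 (U1a) NOT PROVED**; spine PROVED 0/9 unchanged; NOT infinite volume, NOT a mass gap, NOT
Clay.  HONEST DEPENDENCY: continuum YM on T⁴ ⇐ BetaPertH ∧ nine spine estimates (0/9 proved); BetaPertH ⇐ (D1) ∧ (D4) ∧
CAP+tail; G-an2-4 gates asym, D1 and NE2/3/4.  ABSOLUTE RULE kept: inputs are kernel-proved tree modules BY NAME; no
`def … : Prop` fact; no new definition; no `sorry`.
-/

noncomputable section

open scoped BigOperators ComplexConjugate Matrix Matrix.Norms.L2Operator Kronecker
open Filter Topology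

namespace Summit.QuantumFields.BalabanUV.T4Continuum.FreeTowerEntryDecay

open Literature.MathematicalPhysics.QuantumFieldTheory.Balaban1983to89.B5Prop11Plancherel (Cst Tor fine)
open Literature.MathematicalPhysics.QuantumFieldTheory.Balaban1983to89.B5G183RateUnitTower (lev Qtow unitAvg unitAvg_apply)
open Literature.MathematicalPhysics.QuantumFieldTheory.Balaban1983to89.B4TorusKernel (periodConst)
open Literature.MathematicalPhysics.QuantumFieldTheory.Balaban1983to89.B4TorusKernel.MultiPeriod (torusSupNorm torusSupNorm_nonneg)
open Literature.MathematicalPhysics.QuantumFieldTheory.Balaban1983to89.B5Block118 (bpt)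
open Literature.MathematicalPhysics.QuantumFieldTheory.Balaban1983to89.B5Blocks16 (blockOf blockOf_bpt bpt_bijective bpt_val)
open Literature.MathematicalPhysics.QuantumFieldTheory.Balaban1983to89.B5DeltaA169 (DeltaA calG_eq_DeltaA_inv)
open Literature.MathematicalPhysics.QuantumFieldTheory.Balaban1983to89.B5G183Strip (kappa183 kappa183_pos)
open Literature.MathematicalPhysics.QuantumFieldTheory.Balaban1983to89.B5G183CovDecay (MD183 MD183_nonneg)
open Literature.MathematicalPhysics.QuantumFieldTheory.Balaban1983to89.B5Kernel166Decay (periodConst_pos)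
open Literature.MathematicalPhysics.QuantumFieldTheory.Balaban1983to89.B6LowerBound2153Torus (rep)
open Literature.MathematicalPhysics.QuantumFieldTheory.Balaban1983to89.B6Cov2156Torus (one_le_M)
open Literature.MathematicalPhysics.QuantumFieldTheory.Balaban1983to89.B5G110BlockRowSum (block_row_sum_le)
open Summit.QuantumFields.BalabanUV.T4Continuum
open Summit.QuantumFields.BalabanUV.T4Continuum.CovariantAveragingTower (Atow Atow_succ avgTow)
open Summit.QuantumFields.BalabanUV.T4Continuum.BalabanAveragedTowerUnit (idx Qlev calGlev one_le_lev' cast_lev')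
open Summit.QuantumFields.BalabanUV.T4Continuum.BackgroundResolventTower
open Summit.QuantumFields.BalabanUV.T4Continuum.KingPairingPlantedLaw
open Summit.QuantumFields.BalabanUV.T4Continuum.PerturbationAlgebra (perturbationLaws_zero perturbationLaws_mono)
open Summit.QuantumFields.BalabanUV.T4Continuum.NE2ColourPerturbedLayer (pertCovC pertLimC pertCovC_zero)
open Summit.QuantumFields.BalabanUV.T4Continuum.ColourPerturbedStations (avgTow_kron)
open Summit.QuantumFields.BalabanUV.T4Continuum.DecayRateInterpolation (EntryDecay DecayRate TwoLevelDecayRate)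
open Summit.QuantumFields.BalabanUV.T4Continuum.NE2BalabanDecayRate (decayStations_pertCovC)

section General

variable {d : ℕ} (L : ℕ) [NeZero L] (M : Fin d → ℕ) [hM : ∀ μ, NeZero (M μ)] (a : ℝ) (ha : 0 < a)
variable {o : Type*} [Fintype o] [DecidableEq o]

/-! ## §1 At `t = 0` the colour tower's entries are the block means of `𝒢^{(k)}` -/

/-- `Atow (Qlev) k = Qtow k`: the Spine composite of King's one-step averagings IS the Literature tower's composite
(same recursion, definitional step by step). [folklore] -/
theorem Atow_Qlev (k : ℕ) : Atow (Qlev L M) k = Qtow L M k := by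
  induction k with
  | zero => rfl
  | succ k ih => rw [Atow_succ, ih]; rfl

omit [NeZero L] hM in
/-- `(L^d)^k = n_k^d` in `ℂ`. [folklore] -/
theorem pow_Ld_eq (k : ℕ) : ((((L : ℝ) ^ d : ℝ) : ℂ)) ^ k = (((lev L k : ℕ) : ℂ)) ^ d := by
  rw [show (((lev L k : ℕ) : ℂ)) = (L : ℂ) ^ k by exact_mod_cast cast_lev' L k, ← pow_mul, Complex.ofReal_pow,
    Complex.ofReal_natCast, ← pow_mul, mul_comm]

/-- `avgTow Qlev (L^d) X k = unitAvg X k` (the Spine and the Literature spellings of King's unit-lattice image). [folklore] -/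
theorem avgTow_Qlev_eq_unitAvg (X : (k : ℕ) → Matrix (idx L M k) (idx L M k) ℂ) (k : ℕ) :
    avgTow (Qlev L M) ((L : ℝ) ^ d) X k = unitAvg L M X k := by
  rw [avgTow, unitAvg, Atow_Qlev, pow_Ld_eq]

/-- **AT `t = 0` THE ENTRIES OF THE COLOUR TOWER ARE THE BLOCK MEANS OF `𝒢^{(k)}`, DIAGONAL IN COLOUR** (any `P`). [folklore] -/
theorem pertCovC_zero_apply (P : (k : ℕ) → Matrix (idx L M k × o) (idx L M k × o) ℂ) (k : ℕ)
    (x x' : idx L M 0) (c c' : o) :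
    pertCovC L M a ha P 0 k (x, c) (x', c')
      = unitAvg L M (calGlev L M a ha) k x x' * (if c = c' then 1 else 0) := by
  rw [pertCovC_zero, avgTow_kron, avgTow_Qlev_eq_unitAvg, Matrix.kroneckerMap_apply, Matrix.one_apply]

/-- hence `‖(pertCovC P 0 k)_{(x,c),(x′,c′)}‖ ≤ ‖(unitAvg calGlev k)_{x x′}‖`. [folklore] -/
theorem norm_pertCovC_zero_apply_le (P : (k : ℕ) → Matrix (idx L M k × o) (idx L M k × o) ℂ) (k : ℕ)
    (i i' : idx L M 0 × o) :
    ‖pertCovC L M a ha P 0 k i i'‖ ≤ ‖unitAvg L M (calGlev L M a ha) k i.1 i'.1‖ := by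
  obtain ⟨x, c⟩ := i; obtain ⟨x', c'⟩ := i'
  rw [pertCovC_zero_apply]
  by_cases h : c = c' <;> simp [h]

/-! ## §2 Block bookkeeping on the unit torus -/

/-! Throughout, a unit-lattice site `x : Tor (fine (lev L 0) M) = Π_ν ℤ/(1·M_ν)` is read in `Tor M = Π_ν ℤ/M_ν` as the
value-preserving vector `⟦x⟧ := (fun ν => ((x ν).val : ZMod (M ν)))` (written inline; no definition is introduced). -/

/-- `(x ν).val < M ν` for a unit-lattice site. [folklore] -/
theorem val_lt_M (x : Tor (fine (lev L 0) M)) (ν : Fin d) : (x ν).val < M ν := by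
  have h := ZMod.val_lt (x ν); have e : fine (lev L 0) M ν = M ν := one_mul (M ν); omega

/-- `⟦x⟧` preserves the values. [folklore] -/
theorem val_toTor (x : Tor (fine (lev L 0) M)) (ν : Fin d) : (((x ν).val : ZMod (M ν))).val = (x ν).val :=
  ZMod.val_natCast_of_lt (val_lt_M L M x ν)

/-- `rep M ⟦x⟧ = ` the value vector of `x`. [folklore] -/
theorem rep_toTor (x : Tor (fine (lev L 0) M)) : rep M ((fun ν => ((x ν).val : ZMod (M ν)))) = fun ν => ((x ν).val : ℤ) := by
  funext ν; simp only [rep, val_toTor]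

/-- the block condition of `unitAvg_apply` at a block point: `⌊(n·z + r)_ν / n⌋ = z_ν`. [folklore] -/
theorem bpt_val_div {n : ℕ} [NeZero n] (z : Tor M) (r : Fin d → Fin n) (ν : Fin d) :
    (bpt n M z r ν).val / n = (z ν).val := by
  have hn : 0 < n := Nat.pos_of_ne_zero (NeZero.ne n)
  rw [bpt_val, Nat.mul_add_div hn, Nat.div_eq_of_lt (r ν).isLt, add_zero]

/-- **THE BLOCK CONDITION IS `blockOf = ⟦x⟧`**: for a fine site `y` of level `n` and a unit-lattice site `x`,
`(∀ ν, ⌊y_ν/n⌋ = x_ν) ↔ blockOf y = ⟦x⟧`. [folklore] -/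
theorem block_cond_iff {n : ℕ} [NeZero n] (y : Tor (fine n M)) (x : Tor (fine (lev L 0) M)) :
    (∀ ν, (y ν).val / n = (x ν).val) ↔ blockOf n M y = (fun ν => ((x ν).val : ZMod (M ν))) := by
  obtain ⟨⟨z, r⟩, hzr⟩ := (bpt_bijective n M).2 y
  simp only at hzr
  subst hzr
  rw [blockOf_bpt]
  simp_rw [bpt_val_div]
  refine ⟨fun h => funext fun ν => ZMod.val_injective _ ?_, fun h ν => by rw [h, val_toTor]⟩
  rw [h ν, val_toTor]

/-- for a block point the condition reads `z = ⟦x⟧`. [folklore] -/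
theorem block_cond_bpt_iff {n : ℕ} [NeZero n] (z : Tor M) (r : Fin d → Fin n) (x : Tor (fine (lev L 0) M)) :
    (∀ ν, (bpt n M z r ν).val / n = (x ν).val) ↔ z = (fun ν => ((x ν).val : ZMod (M ν))) := by
  rw [block_cond_iff, blockOf_bpt]

/-- **BLOCK SUMS RE-INDEXED BY OFFSETS**: `Σ_y 1[y ∈ B(x)]·f(y) = Σ_r f(n·⟦x⟧ + r)` (every fine site is exactly one
block point, `B5Blocks16.bpt_bijective`). [folklore] -/
theorem sum_block_ite {n : ℕ} [NeZero n] (x : Tor (fine (lev L 0) M)) (f : Tor (fine n M) → ℝ) :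
    ∑ y : Tor (fine n M), (if (∀ ν, (y ν).val / n = (x ν).val) then f y else 0)
      = ∑ r : Fin d → Fin n, f (bpt n M ((fun ν => ((x ν).val : ZMod (M ν)))) r) := by
  rw [← (Equiv.ofBijective _ (bpt_bijective n M)).sum_comp, Fintype.sum_prod_type]
  simp only [Equiv.ofBijective_apply]
  simp_rw [block_cond_bpt_iff]
  rw [Finset.sum_comm]
  refine Finset.sum_congr rfl fun r _ => ?_
  rw [Finset.sum_ite_eq']
  simp

/-- the same with a component constraint: `Σ_{(y,κ)} 1[κ = μ ∧ y ∈ B(x)]·c = n^d·c`. [folklore] -/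
theorem sum_block_comp_ite_const {n : ℕ} [NeZero n] (x : Tor (fine (lev L 0) M)) (μ : Fin d) (c : ℝ) :
    ∑ y : Tor (fine n M) × Fin d, (if (y.2 = μ ∧ ∀ ν, (y.1 ν).val / n = (x ν).val) then c else 0)
      = ((n : ℝ) ^ d) * c := by
  rw [Fintype.sum_prod_type]
  have hin : ∀ y1 : Tor (fine n M),
      ∑ y2 : Fin d, (if ((y1, y2).2 = μ ∧ ∀ ν, ((y1, y2).1 ν).val / n = (x ν).val) then c else 0)
        = if (∀ ν, (y1 ν).val / n = (x ν).val) then c else 0 := by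
    intro y1
    by_cases hb : ∀ ν, (y1 ν).val / n = (x ν).val
    · have e : ∀ y2 : Fin d, ((y1, y2).2 = μ ∧ ∀ ν, ((y1, y2).1 ν).val / n = (x ν).val) ↔ y2 = μ :=
        fun y2 => ⟨fun h => h.1, fun h => ⟨h, hb⟩⟩
      rw [if_pos hb]
      simp_rw [e]
      rw [Finset.sum_ite_eq']
      simp
    · rw [if_neg hb]
      exact Finset.sum_eq_zero fun y2 _ => if_neg fun h => hb h.2
  simp_rw [hin]
  rw [sum_block_ite, Finset.sum_const, Finset.card_univ, nsmul_eq_mul, Fintype.card_pi]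
  simp only [Finset.prod_const, Finset.card_univ, Fintype.card_fin]
  push_cast
  ring

omit [NeZero L] hM in
/-- `‖Σ_y Σ_{y′} 1_p(y)·X(y,y′)·1_q(y′)‖ ≤ Σ_y 1_p(y)·Σ_{y′} 1_q(y′)·‖X(y,y′)‖` (indicator-sandwiched triangle inequality). [folklore] -/
theorem norm_sum_indicator_mul_le {ι : Type*} [Fintype ι] (p q : ι → Prop) [DecidablePred p] [DecidablePred q]
    (X : Matrix ι ι ℂ) :
    ‖∑ y, ∑ y', (if p y then (1 : ℂ) else 0) * X y y' * (if q y' then (1 : ℂ) else 0)‖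
      ≤ ∑ y, (if p y then ∑ y', (if q y' then ‖X y y'‖ else 0) else 0) := by
  refine (norm_sum_le _ _).trans (Finset.sum_le_sum fun y _ => ?_)
  by_cases hy : p y
  · rw [if_pos hy, if_pos hy]
    refine (norm_sum_le _ _).trans (Finset.sum_le_sum fun y' _ => ?_)
    by_cases hy' : q y'
    · rw [if_pos hy', if_pos hy', one_mul, mul_one]
    · rw [if_neg hy', if_neg hy', mul_zero, norm_zero]
  · rw [if_neg hy, if_neg hy]
    simp only [zero_mul, Finset.sum_const_zero, norm_zero, le_refl]

/-- dropping the component and the exact block condition on the COLUMN index only enlarges a sum of nonnegative terms: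
`Σ_{y′} 1[y′ ∈ B(x′)×{ν}]·‖X y y′‖ ≤ Σ_j 1[blockOf j = ⟦x′⟧]·‖X y j‖`. [folklore] -/
theorem sum_col_le {n : ℕ} [NeZero n] (X : Matrix (Tor (fine n M) × Fin d) (Tor (fine n M) × Fin d) ℂ)
    (y : Tor (fine n M) × Fin d) (x' : Tor (fine (lev L 0) M)) (ν : Fin d) :
    ∑ y' : Tor (fine n M) × Fin d,
        (if (y'.2 = ν ∧ ∀ μ, (y'.1 μ).val / n = (x' μ).val) then ‖X y y'‖ else 0)
      ≤ ∑ j : Tor (fine n M) × Fin d, (if blockOf n M j.1 = (fun ν => ((x' ν).val : ZMod (M ν))) then ‖X y j‖ else 0) := by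
  refine Finset.sum_le_sum fun j _ => ?_
  by_cases h : (j.2 = ν ∧ ∀ μ, (j.1 μ).val / n = (x' μ).val)
  · rw [if_pos h, if_pos ((block_cond_iff L M j.1 x').mp h.2)]
  · rw [if_neg h]
    split_ifs
    · exact norm_nonneg _
    · exact le_rfl

/-- **A PER-BLOCK `ℓ¹` ROW-SUM BOUND BOUNDS THE ENTRIES OF THE UNIT-LATTICE IMAGE**: if every row `(n·z + r, μ)` of `X_k`
has `Σ_{j ∈ B(z′)×dirs} ‖X_k(row, j)‖ ≤ R(z, z′)`, then `‖(unitAvg X k)_{(x,μ),(x′,ν)}‖ ≤ R(⟦x⟧, ⟦x′⟧)`. [folklore] -/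
theorem norm_unitAvg_apply_le (X : (k : ℕ) → Matrix (idx L M k) (idx L M k) ℂ) (k : ℕ) {R : Tor M → Tor M → ℝ}
    (hrow : ∀ (z z' : Tor M) (r : Fin d → Fin (lev L k)) (μ : Fin d),
      ∑ j : idx L M k, (if blockOf (lev L k) M j.1 = z' then ‖X k (bpt (lev L k) M z r, μ) j‖ else 0) ≤ R z z')
    (x x' : Tor (fine (lev L 0) M)) (μ ν : Fin d) :
    ‖unitAvg L M X k (x, μ) (x', ν)‖ ≤ R ((fun ν => ((x ν).val : ZMod (M ν)))) ((fun ν => ((x' ν).val : ZMod (M ν)))) := by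
  have hn0 : (0 : ℝ) < (((lev L k : ℕ) : ℝ)) ^ d :=
    pow_pos (by exact_mod_cast Nat.pos_of_ne_zero (NeZero.ne (lev L k))) d
  have hpre : ‖((((lev L k : ℕ) : ℂ)) ^ d)⁻¹‖ = ((((lev L k : ℕ) : ℝ)) ^ d)⁻¹ := by
    rw [norm_inv, norm_pow, Complex.norm_natCast]
  -- the rows of the block `B(x) × {μ}` each contribute at most `R`
  have hrows : ∀ y : idx L M k, (if (y.2 = μ ∧ ∀ ν', (y.1 ν').val / lev L k = (x ν').val) then
      ∑ y' : idx L M k, (if (y'.2 = ν ∧ ∀ ν', (y'.1 ν').val / lev L k = (x' ν').val) then ‖X k y y'‖ else 0) else 0)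
      ≤ (if (y.2 = μ ∧ ∀ ν', (y.1 ν').val / lev L k = (x ν').val) then R ((fun ν => ((x ν).val : ZMod (M ν)))) ((fun ν => ((x' ν).val : ZMod (M ν)))) else 0) := by
    intro y
    by_cases hy : (y.2 = μ ∧ ∀ ν', (y.1 ν').val / lev L k = (x ν').val)
    · rw [if_pos hy, if_pos hy]
      refine (sum_col_le L M (X k) y x' ν).trans ?_
      obtain ⟨⟨z, r⟩, hzr⟩ := (bpt_bijective (lev L k) M).2 y.1
      simp only at hzr
      have hz : z = (fun ν => ((x ν).val : ZMod (M ν))) := by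
        rw [← block_cond_bpt_iff L M z r x]
        intro ν'; rw [hzr]; exact hy.2 ν'
      have hy1 : y = (bpt (lev L k) M ((fun ν => ((x ν).val : ZMod (M ν)))) r, μ) := Prod.ext (by rw [← hzr, hz]) hy.1
      rw [hy1]
      exact hrow ((fun ν => ((x ν).val : ZMod (M ν)))) ((fun ν => ((x' ν).val : ZMod (M ν)))) r μ
    · rw [if_neg hy, if_neg hy]
  have hsum := (norm_sum_indicator_mul_le
      (fun y : idx L M k => y.2 = μ ∧ ∀ ν', (y.1 ν').val / lev L k = (x ν').val)
      (fun y' : idx L M k => y'.2 = ν ∧ ∀ ν', (y'.1 ν').val / lev L k = (x' ν').val) (X k)).trans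
    ((Finset.sum_le_sum fun y _ => hrows y).trans (sum_block_comp_ite_const L M x μ _).le)
  rw [unitAvg_apply, norm_mul, hpre]
  calc ((((lev L k : ℕ) : ℝ)) ^ d)⁻¹ * ‖∑ y : idx L M k, ∑ y' : idx L M k,
          (if (y.2 = (x, μ).2 ∧ ∀ ν', (y.1 ν').val / lev L k = ((x, μ).1 ν').val) then (1 : ℂ) else 0) *
            X k y y' * (if (y'.2 = (x', ν).2 ∧ ∀ ν', (y'.1 ν').val / lev L k = ((x', ν).1 ν').val) then (1 : ℂ) else 0)‖
      ≤ ((((lev L k : ℕ) : ℝ)) ^ d)⁻¹ * (((((lev L k : ℕ) : ℝ)) ^ d) * R ((fun ν => ((x ν).val : ZMod (M ν)))) ((fun ν => ((x' ν).val : ZMod (M ν))))) :=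
        mul_le_mul_of_nonneg_left hsum (inv_nonneg.mpr hn0.le)
    _ = R ((fun ν => ((x ν).val : ZMod (M ν)))) ((fun ν => ((x' ν).val : ZMod (M ν)))) := by
        rw [← mul_assoc, inv_mul_cancel₀ hn0.ne', one_mul]

end General

/-! ## §3 `a = 1`, dimension `d + 1`: the level-uniform entry decay of the free colour tower -/

section Decay

variable {d : ℕ} (L : ℕ) [NeZero L] (M : Fin (d + 1) → ℕ) [hM : ∀ μ, NeZero (M μ)]
variable {o : Type*} [Fintype o] [DecidableEq o]

omit [NeZero L] hM in
/-- `C₁e^{−δ₁T} + C₂e^{−δ₂T} ≤ (C₁ + C₂)·e^{−min(δ₁,δ₂)·T}` for `C₁, C₂, T ≥ 0`. [folklore] -/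
theorem two_rates_le {C₁ C₂ δ₁ δ₂ T : ℝ} (h1 : 0 ≤ C₁) (h2 : 0 ≤ C₂) (hT : 0 ≤ T) :
    C₁ * Real.exp (-(δ₁ * T)) + C₂ * Real.exp (-(δ₂ * T)) ≤ (C₁ + C₂) * Real.exp (-(min δ₁ δ₂ * T)) := by
  have e1 : Real.exp (-(δ₁ * T)) ≤ Real.exp (-(min δ₁ δ₂ * T)) :=
    Real.exp_le_exp.mpr (by nlinarith [min_le_left δ₁ δ₂])
  have e2 : Real.exp (-(δ₂ * T)) ≤ Real.exp (-(min δ₁ δ₂ * T)) :=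
    Real.exp_le_exp.mpr (by nlinarith [min_le_right δ₁ δ₂])
  rw [add_mul]
  exact add_le_add (mul_le_mul_of_nonneg_left e1 h1) (mul_le_mul_of_nonneg_left e2 h2)

/-- **THE BLOCK ROW SUMS OF `𝒢^{(k)}` AT `a = 1`, ONE RATE** (pv15's `B5G110BlockRowSum.block_row_sum_le` BY NAME at
`n = n_k`, truncation order `N := d`, the two rates merged): for every level `k`, every row `(n_k·z + r, μ)` and every
block `B(z′)`, `Σ_{j ∈ B(z′)×dirs} ‖𝒢^{(k)}(row, j)‖ ≤ (C₁ + (d+1)C₂)·e^{−min(δ₁,δ₂)·|z − z′|_{T₁,∞}}` — uniform in `k` and in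
the volume. [cite: Balaban1984PropagatorsI, Prop. 1.2 (1.110) p.35 (location; typed row-sum form pv15's, constants ours)]
[folklore] -/
theorem blockRowSum_calGlev_one_le (k : ℕ) (z z' : Tor M) (r : Fin (d + 1) → Fin (lev L k)) (μ : Fin (d + 1)) :
    ∑ j : idx L M k, (if blockOf (lev L k) M j.1 = z' then ‖calGlev L M 1 one_pos k (bpt (lev L k) M z r, μ) j‖ else 0)
      ≤ (2 * d * 2 ^ d * Real.exp (1 / (2 * (d + 1)))
            + (d + 1) * (MD183 (d + 1) d * periodConst (kappa183 (d + 1)) d)) *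
          Real.exp (-(min ((1 : ℝ) / (2 * (d + 1))) (kappa183 (d + 1) / (d + 1)) * torusSupNorm M (rep M z - rep M z'))) := by
  have hG : calGlev L M 1 one_pos k = (DeltaA (lev L k) M 1)⁻¹ :=
    calG_eq_DeltaA_inv (lev L k) (one_le_lev' L k) M 1 one_pos
  rw [hG]
  refine (block_row_sum_le (lev L k) (one_le_lev' L k) M (Nn := d) le_rfl z z' r μ).trans ?_
  have hT : 0 ≤ torusSupNorm M (rep M z - rep M z') := torusSupNorm_nonneg (one_le_M M) _
  have h1 : (0 : ℝ) ≤ 2 * d * 2 ^ d * Real.exp (1 / (2 * (d + 1))) := by positivity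
  have h2 : (0 : ℝ) ≤ (d + 1) * (MD183 (d + 1) d * periodConst (kappa183 (d + 1)) d) :=
    mul_nonneg (by positivity) (mul_nonneg (MD183_nonneg _ _) (periodConst_pos (kappa183_pos _) d).le)
  refine le_trans (le_of_eq ?_) (two_rates_le h1 h2 hT)
  ring

/-- **`hdec` AT `U = 1` (`t = 0`), `a = 1`: THE LEVEL-UNIFORM ENTRY DECAY OF THE FREE KING-AVERAGED COLOUR TOWER** — for
EVERY perturbation family `P` (the coupling `t = 0` kills it), every `L ≥ 1`, every torus `M`, every level `k` and all
unit-lattice indices `((x,μ),c), ((x′,ν),c′)`: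
`‖(pertCovC P 0 k)_{((x,μ),c),((x′,ν),c′)}‖ ≤ (C₁ + (d+1)C₂)·e^{−min(δ₁,δ₂)·|x − x′|_{T₁,∞}}`, `|·|_{T₁,∞}` the sup-distance of
the unit torus `Π_ν ℤ/M_ν` (on value representatives, `B4TorusKernel.MultiPeriod.torusSupNorm`), `C₁ = 2d·2^d·e^{δ₁}`,
`δ₁ = 1/(2(d+1))`, `C₂ = MD183(d+1,d)·periodConst(κ₁₈₃(d+1),d)`, `δ₂ = κ₁₈₃(d+1)/(d+1)` — the displayed binder `hdec` of
`NE2BalabanDecayRate.decayStations_pertCovC` DISCHARGED at `U = 1`.  `U ≠ 1` is NOT touched (B0 / NE2⁺); NE2 NOT proved.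
[cite: Balaban1984PropagatorsI, Prop. 1.2 (1.110) p.35 (location); King1986, Lemma 4.5 (4.34) p.674 (shape)] [folklore] -/
theorem entryDecay_pertCovC_zero (P : (k : ℕ) → Matrix (idx L M k × o) (idx L M k × o) ℂ) (k : ℕ) :
    EntryDecay (fun i i' : idx L M 0 × o =>
        torusSupNorm M (fun ν => (((i.1.1 ν).val : ℕ) : ℤ) - (((i'.1.1 ν).val : ℕ) : ℤ)))
      (pertCovC L M 1 one_pos P 0 k)
      (2 * d * 2 ^ d * Real.exp (1 / (2 * (d + 1))) + (d + 1) * (MD183 (d + 1) d * periodConst (kappa183 (d + 1)) d))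
      (min ((1 : ℝ) / (2 * (d + 1))) (kappa183 (d + 1) / (d + 1))) := by
  rintro ⟨⟨x, μ⟩, c⟩ ⟨⟨x', ν⟩, c'⟩
  refine (norm_pertCovC_zero_apply_le L M 1 one_pos P k _ _).trans ?_
  refine (norm_unitAvg_apply_le L M (calGlev L M 1 one_pos) k (blockRowSum_calGlev_one_le L M k) x x' μ ν).trans
    (le_of_eq ?_)
  dsimp only
  rw [rep_toTor, rep_toTor]
  rfl

/-! ## §4 The ENDs: the owner's decay stations at `t = 0` with `hdec` discharged -/

/-- **THE OWNER's DECAY STATIONS AT `U = 1` WITH `hdec` DISCHARGED** (`L ≥ 2`, `a = 1`, dimension `d + 1`): for every family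
`P` obeying the rate-`L⁻¹` laws (any `κ`, `C₂`; at `t = 0` only the free tower is read): limit entry decay
`(C₁ + (d+1)C₂, min(δ₁,δ₂))` of `pertLimC P 0` and King's (4.38) limit / two-level shapes with
`(√(2B·Cpert(0)/(1−L⁻¹)), min(δ₁,δ₂)/2, √(L⁻¹))` resp. `(√(2B·2Cpert(0)/(1−L⁻¹)), …)` — `NE2BalabanDecayRate.decayStations_pertCovC`
BY NAME at `t = 0`, `hdec := entryDecay_pertCovC_zero` (the rate-`ρ` form is the same one-liner on `decayStations_pertCovC_rate`).
`U = 1` only; NE2 NOT proved. [cite: King1986, Lemma 4.5 (4.38) p.674 (shape)] [folklore] -/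
theorem decayStations_pertCovC_zero (hL : 2 ≤ L) {P : (k : ℕ) → Matrix (idx L M k × o) (idx L M k × o) ℂ} {κ C₂ : ℝ}
    (hpert : PerturbationLaws (fun k => calDalev L M 1 one_pos k ⊗ₖ (1 : Matrix o o ℂ)) P
      (fun k => JpcT L M k ⊗ₖ (1 : Matrix o o ℂ)) κ (fun k => C₂ * ((L : ℝ)⁻¹) ^ k)) :
    EntryDecay (fun i i' : idx L M 0 × o =>
        torusSupNorm M (fun ν => (((i.1.1 ν).val : ℕ) : ℤ) - (((i'.1.1 ν).val : ℕ) : ℤ)))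
        (pertLimC L M 1 one_pos P 0)
        (2 * d * 2 ^ d * Real.exp (1 / (2 * (d + 1))) + (d + 1) * (MD183 (d + 1) d * periodConst (kappa183 (d + 1)) d))
        (min ((1 : ℝ) / (2 * (d + 1))) (kappa183 (d + 1) / (d + 1))) ∧
      DecayRate (fun i i' : idx L M 0 × o =>
          torusSupNorm M (fun ν => (((i.1.1 ν).val : ℕ) : ℤ) - (((i'.1.1 ν).val : ℕ) : ℤ)))
        (pertCovC L M 1 one_pos P 0) (pertLimC L M 1 one_pos P 0)
        (Real.sqrt (2 * (2 * d * 2 ^ d * Real.exp (1 / (2 * (d + 1)))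
            + (d + 1) * (MD183 (d + 1) d * periodConst (kappa183 (d + 1)) d)) *
          (Cpert κ (2 * ((d + 1 : ℕ) : ℝ) * Cst (d + 1) 1) (CJ (d + 1) 1) C₂ 0 0 / (1 - (L : ℝ)⁻¹))))
        (min ((1 : ℝ) / (2 * (d + 1))) (kappa183 (d + 1) / (d + 1)) / 2) (Real.sqrt ((L : ℝ)⁻¹)) ∧
      TwoLevelDecayRate (fun i i' : idx L M 0 × o =>
          torusSupNorm M (fun ν => (((i.1.1 ν).val : ℕ) : ℤ) - (((i'.1.1 ν).val : ℕ) : ℤ)))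
        (pertCovC L M 1 one_pos P 0)
        (Real.sqrt (2 * (2 * d * 2 ^ d * Real.exp (1 / (2 * (d + 1)))
            + (d + 1) * (MD183 (d + 1) d * periodConst (kappa183 (d + 1)) d)) *
          (2 * Cpert κ (2 * ((d + 1 : ℕ) : ℝ) * Cst (d + 1) 1) (CJ (d + 1) 1) C₂ 0 0 / (1 - (L : ℝ)⁻¹))))
        (min ((1 : ℝ) / (2 * (d + 1))) (kappa183 (d + 1) / (d + 1)) / 2) (Real.sqrt ((L : ℝ)⁻¹)) :=
  decayStations_pertCovC L M 1 one_pos hL hpert (t := 0) (by rw [norm_zero, zero_mul]; exact one_pos)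
    (entryDecay_pertCovC_zero L M P)

/-- **THE FREE TOWER's DECAY STATIONS — `P := 0`, binder `L ≥ 2` AND NOTHING ELSE**: at `U = 1` the King-averaged free
colour covariances `(L^d)^k·(Q_k⊗1)(𝒢^{(k)}⊗1)(Q_k⊗1)ᴴ` (`a = 1`, dimension `d + 1`) converge to `pertLimC 0 0` with limit
entry decay `(C₁ + (d+1)C₂, min(δ₁,δ₂))` and King's (4.38) shapes (rate `√(L⁻¹)`, decay `min(δ₁,δ₂)/2`) — UNCONDITIONALLY:
the `U = 1` witness of sub-row Δ3's conversion.  NE2 NOT proved. [cite: King1986, Lemma 4.5 (4.38) p.674 (shape)] [folklore] -/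
theorem decayStations_free (hL : 2 ≤ L) :
    EntryDecay (fun i i' : idx L M 0 × o =>
        torusSupNorm M (fun ν => (((i.1.1 ν).val : ℕ) : ℤ) - (((i'.1.1 ν).val : ℕ) : ℤ)))
        (pertLimC L M 1 one_pos (fun k => (0 : Matrix (idx L M k × o) (idx L M k × o) ℂ)) 0)
        (2 * d * 2 ^ d * Real.exp (1 / (2 * (d + 1))) + (d + 1) * (MD183 (d + 1) d * periodConst (kappa183 (d + 1)) d))
        (min ((1 : ℝ) / (2 * (d + 1))) (kappa183 (d + 1) / (d + 1))) ∧
      DecayRate (fun i i' : idx L M 0 × o =>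
          torusSupNorm M (fun ν => (((i.1.1 ν).val : ℕ) : ℤ) - (((i'.1.1 ν).val : ℕ) : ℤ)))
        (pertCovC L M 1 one_pos (fun k => (0 : Matrix (idx L M k × o) (idx L M k × o) ℂ)) 0)
        (pertLimC L M 1 one_pos (fun k => (0 : Matrix (idx L M k × o) (idx L M k × o) ℂ)) 0)
        (Real.sqrt (2 * (2 * d * 2 ^ d * Real.exp (1 / (2 * (d + 1)))
            + (d + 1) * (MD183 (d + 1) d * periodConst (kappa183 (d + 1)) d)) *
          (Cpert 0 (2 * ((d + 1 : ℕ) : ℝ) * Cst (d + 1) 1) (CJ (d + 1) 1) 0 0 0 / (1 - (L : ℝ)⁻¹))))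
        (min ((1 : ℝ) / (2 * (d + 1))) (kappa183 (d + 1) / (d + 1)) / 2) (Real.sqrt ((L : ℝ)⁻¹)) ∧
      TwoLevelDecayRate (fun i i' : idx L M 0 × o =>
          torusSupNorm M (fun ν => (((i.1.1 ν).val : ℕ) : ℤ) - (((i'.1.1 ν).val : ℕ) : ℤ)))
        (pertCovC L M 1 one_pos (fun k => (0 : Matrix (idx L M k × o) (idx L M k × o) ℂ)) 0)
        (Real.sqrt (2 * (2 * d * 2 ^ d * Real.exp (1 / (2 * (d + 1)))
            + (d + 1) * (MD183 (d + 1) d * periodConst (kappa183 (d + 1)) d)) *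
          (2 * Cpert 0 (2 * ((d + 1 : ℕ) : ℝ) * Cst (d + 1) 1) (CJ (d + 1) 1) 0 0 0 / (1 - (L : ℝ)⁻¹))))
        (min ((1 : ℝ) / (2 * (d + 1))) (kappa183 (d + 1) / (d + 1)) / 2) (Real.sqrt ((L : ℝ)⁻¹)) :=
  decayStations_pertCovC_zero L M hL
    (perturbationLaws_mono perturbationLaws_zero le_rfl fun _ => (zero_mul _).symm.le)

end Decay

end Summit.QuantumFields.BalabanUV.T4Continuum.FreeTowerEntryDecay

end
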